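import Literature.NumberTheory.GaloisRepresentations.ChebotarevArtinRep
import HarnessLib

/-!
# Chebotarev's theorem for Artin representations from the cyclotomic case — RETIRED MODULE

Topic `Literature/NumberTheory/Automorphic`.  This module holds one **deprecated alias**,
`Literature.NumberTheory.Automorphic.chebotarev_artinRep_of_cyclotomic :
GaloisRepresentations.chebotarev_cyclotomicExtension → GaloisRepresentations.chebotarevArtinRep`
(the Chebotarev–Deuring reduction of Chebotarev's density theorem for Artin
representations, existence form — Tate, *Global class field theory*, Ch. VII of
Cassels–Fröhlich, §2.4 — to its cyclotomic case), whose body is literally the Galois-side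
theorem

* `Literature.NumberTheory.GaloisRepresentations.chebotarevArtinRep_of_cyclotomic`
  (`GaloisRepresentations/ChebotarevArtinRep.lean`),

i.e. a duplicate under a second fully-qualified name (gate alias probe, dedup item
`dedup-02976`; the statement is moreover closed outright by
`GaloisRepresentations.chebotarevArtinRep_holds`, the cyclotomic case being proved in
`GaloisRepresentations/ChebotarevCyclotomicProofs.lean`).  Its four importers were rewired to the
Galois-side declarations (`Automorphic/ChebotarevArtinRepCyclicProofs`,
`EllipticCurves/TorsionFrobeniusChebotarevProofs`:
`GaloisRepresentations.chebotarevArtinRep_of_cyclotomic`;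
`EllipticCurves/HeegnerPointsKolyvaginProp21Proofs`:
`GaloisRepresentations.chebotarevArtinRep_holds`; `Automorphic/ChebotarevArtinRepHolds`: import
dropped), so nothing imports this module any more; the name is kept only as a `@[deprecated]`
pointer (a module must declare something, and tree files are never deleted by agents).

Use instead:

* the theorem: `Literature.NumberTheory.GaloisRepresentations.chebotarevArtinRep_holds`
  (automorphic-namespace name: `Literature.NumberTheory.Automorphic.chebotarev_artinRep_holds`,
  `Automorphic/ChebotarevArtinRepHolds.lean`);
* the reduction itself:
  `Literature.NumberTheory.GaloisRepresentations.chebotarevArtinRep_of_cyclotomic`;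
* the pointwise form: `FramedArtinRep.infinite_setOf_isArithFrobAt_apply_eq` (namespace
  `Literature.NumberTheory.GaloisRepresentations`).

## References

* J. Tate, *Global class field theory*, Ch. VII of Cassels–Fröhlich (1967), §2.4. [TateGCFT1967]
-/

noncomputable section

namespace Literature.NumberTheory.Automorphic

/-- Deprecated duplicate (dedup item `dedup-02976`): use
`GaloisRepresentations.chebotarevArtinRep_holds` (Chebotarev's density theorem for Artin
representations, existence form, proved outright), or the reduction
`GaloisRepresentations.chebotarevArtinRep_of_cyclotomic` of which this is a verbatim copy.
[cite: TateGCFT1967, §2.4 Tchebotarev density theorem] -/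
@[deprecated GaloisRepresentations.chebotarevArtinRep_holds (since := "2026-08-17")]
theorem chebotarev_artinRep_of_cyclotomic
    (h : GaloisRepresentations.chebotarev_cyclotomicExtension) :
    GaloisRepresentations.chebotarevArtinRep :=
  GaloisRepresentations.chebotarevArtinRep_of_cyclotomic h

end Literature.NumberTheory.Automorphic

end
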